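import Mathlib.LinearAlgebra.FiniteDimensional.Lemmas
import Mathlib.LinearAlgebra.Dimension.Finite
import Mathlib.LinearAlgebra.Dimension.Constructions
import Mathlib.Data.Nat.Bits
import Mathlib.Algebra.BigOperators.Group.Finset.Basic
import HarnessLib

/-!
# Route `KolyvaginRoadThree`, deciding crux `ZhangSharpFrameAtThreeHL` (item stmt-BirchSwinnertonDyer-19574):
# W. Zhang's TRIANGULAR BASIS of Kolyvagin classes (Camb. J. Math. 2 (2014), §8, Lemma 8.4 (2) and its proof,
# pp. 236–238) as a `p`-uniform kernel theorem of pure linear algebra — part 1: the sliding-window construction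
# (cell `bsd-stepL`, ACCEL seat `bsd-stepL-koly3b` g3; `--supports stmt-BirchSwinnertonDyer-19574`, helper)

HONEST FRAMING. Nothing about elliptic curves, Heegner points, level raising or `p = 3` is asserted. This file and
its companion `KolyvaginRoadThreeZhangTriangulation.lean` isolate the Galois-cohomological LINEAR ALGEBRA of Zhang's
Lemma 8.4 («triangulization of the Selmer group») as theorems about vector spaces over an arbitrary field `F`, every
number-theoretic input entering as an explicitly named HYPOTHESIS SHAPE. The point for the route: the registered
METHOD engine `ZhangInduction.exists_ne_zero_of_zhangInduction` (zhang3-p1, p441xxx series) consumes the axiom shape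
(A3) TRIANGULATION — «at a level carrying a non-zero class, for some sign `s` and some `d`, `dim Sel^s = d + 1`,
`Sel^s = Sel^s_B` (relaxed at the base locus) and `dim Sel^{−s}_B ≤ d`» — as DATA; the plan g27 ruling of
2026-08-26T23:40:43Z (repair R-b of koly3b g2's STUB-B-ABOVE-BOTTOM memo) asks that (A3) become DERIVABLE from
Kolyvagin-system axioms on the classes instead of being posited. The companion file does exactly that, at ONE fixed
level, uniformly in `F` (so in `p`: Zhang prints `p ≥ 5` for his INPUTS — level raising, Thm. 4.3, Thm. 7.2 — not for
this lemma, whose proof on pp. 236–239 uses only the items below). 0 definitions, 0 named facts, 0 `sorry`.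

## The abstract data (one fixed level of the method skeleton; Zhang §8.1 «Basic properties of κ»)

* an ambient `F`-space `H` (`= H¹(K, V)`, `V = A[𝔭] ≅ E[p]`) with the two eigenspaces `E s` (`s : Bool`) of complex
  conjugation; abstract places `v : P` with local spaces `Hv v` (`= H¹(K_v, V)`), localisations `loc v`, local
  (Tate) pairings `b v`, and the level's Selmer structure `L v ≤ Hv v` (finite ∕ ordinary ∕ the condition at `p`);
* Kolyvagin primes `ℓ : ι` with their place `pl ℓ` (injective: `ℓ` is inert in `K`), the finite and transverse
  parts `Fv ℓ`, `Tv ℓ ≤ Hv (pl ℓ)` [§8.1: `H¹(K_ℓ,V) = H¹_fin ⊕ H¹_tr`, each «totally maximal isotropic», the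
  eigen-lines one-dimensional and `H¹_fin^± × H¹_tr^± → k₀` perfect];
* the classes `c m ∈ H` on finite sets `m` of Kolyvagin primes (Zhang's `c(n)`, `n ∈ Λ`), of sign
  `ε₀ ^^ Nat.bodd m.card` [the sign alternates with the number of prime factors], with property (1)
  [`loc_v c(n) ∈ H¹_fin` for `v ∤ n` — for EVERY place, i.e. the Selmer condition `L v` off the support — and
  `∈ H¹_tr` for `v ∣ n`] and the consequence of (8.1) `loc_ℓ c(nℓ) = ψ_ℓ(loc_ℓ c(n))` (`ψ_ℓ` an isomorphism) that is
  actually used: `loc_ℓ c(nℓ) = 0 ⟺ loc_ℓ c(n) = 0`.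

INPUT SHAPES (hypotheses, named as in the source): (REC) the sum of the local pairings of two global classes over any
finite set of places containing the support of the local terms vanishes [global reciprocity of the Tate pairing,
(8.4)]; (Cheb) = Lemma 8.1 [McCallum 1991 Prop. 3.1: two non-zero classes of opposite signs are simultaneously
non-zero at a positive density of Kolyvagin primes — so at one outside any finite set; and one non-zero class alone];
(Supply) = Lemma 8.2 [McCallum Lemma 5.3: a non-zero class of prescribed sign, Selmer outside `S ∪ {ℓ}`, transverse
at `S`]; (Perf) ∕ (Line): the same-sign finite × transverse pairing of non-zero vectors is non-zero, and the finite
eigen-line is a line; (Iso): `L v` and `Tv ℓ` are isotropic.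

THIS FILE: §1 two lemmas of linear algebra (a family with an upper-triangular, non-degenerate «localisation matrix»
is linearly independent; a subspace whose successive localisations lie on lines has dimension at most the number of
lines plus the dimension of the joint kernel); §2 the basic consequences of the axioms at the VANISHING ORDER `ν`
(classes on `ν` primes vanish locally on their support, hence are Selmer); §3 ONE SLIDING STEP (Zhang p. 237–238,
(8.3)–(8.5): from `c(n_{j+1}) ≠ 0` on `ν` primes and its oldest prime `ℓ_{j+1}`, a fresh Kolyvagin prime `ℓ'` with
`loc_{ℓ'} c(n_{j+1}) ≠ 0` and `c(n_{j+2}) ≠ 0`, `n_{j+2} = n_{j+1} ℓ' ∕ ℓ_{j+1}`). The companion files iterate §3 into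
the CONFIGURATION of Lemma 8.4 (2) (distinct primes `ℓ₁, …, ℓ_{2ν+1}` whose windows `n_i = ℓ_i ⋯ ℓ_{i+ν−1}` carry
classes with `loc_{ℓ_{ν+i}} c(n_i) ≠ 0`; upper-triangularity forced by §2) and derive Lemma 8.4 (1)+(3) = the (A3)
shape. PARTITION: O2@3 (B10) × A1 × crux 19574 — none (composition-engine input discharged from axiom shapes; types
nothing, closes nothing; T7).

References: [cite: WZhang2014, §8.1 properties (1)–(2) and (8.1), Def. 8.3, Lemma 8.1, Lemma 8.2, Lemma 8.4 and
its proof (8.2)–(8.7), pp. 234–239] [cite: McCallumLMS1991, Prop. 3.1, Prop. 4.4, Lemma 5.3]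
[cite: GrossLMS1991, Prop. 8.2 and §9] [cite: Kolyvagin1991MathAnn291, Thm. 3 (the triangular basis for elliptic
curves)].
-/

namespace Summit.BirchSwinnertonDyer.Rank1Residual.X11b.Three.Koly.ZhangTriangulation

open Module Finset

variable {F : Type*} [Field F] {H : Type*} [AddCommGroup H] [Module F H]

/-! ## §1 Linear algebra -/

/-- **Upper-triangular localisation matrix ⟹ linear independence** (the sentence «It is clearly c(nᵢ), 1 ≤ i ≤ ν+1,
are linearly independent» after (8.2)): vectors `w 0, …, w (k-1)` of `H` and linear maps `φ j` (to possibly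
different spaces) with `φ j (w i) = 0` for `j < i` and `φ j (w j) ≠ 0` are linearly independent — apply `φ j` to a
relation, by induction on `j`. [cite: WZhang2014, Lemma 8.4 (2), (8.2)] -/
theorem linearIndependent_of_triangular (k : ℕ) (w : ℕ → H)
    {T : ℕ → Type*} [∀ j, AddCommGroup (T j)] [∀ j, Module F (T j)] (φ : (j : ℕ) → H →ₗ[F] T j)
    (hupper : ∀ i j, j < i → i < k → φ j (w i) = 0) (hdiag : ∀ j < k, φ j (w j) ≠ 0) :
    LinearIndependent F (fun i : Fin k ↦ w i) := by
  rw [Fintype.linearIndependent_iff]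
  intro g hg
  suffices hmain : ∀ (n : ℕ) (i : Fin k), (i : ℕ) < n → g i = 0 from fun i ↦ hmain (i + 1) i (Nat.lt_succ_self _)
  intro n
  induction n with
  | zero => intro i hi; exact absurd hi (Nat.not_lt_zero _)
  | succ n ih =>
    intro i hi
    by_cases hin : (i : ℕ) < n
    · exact ih i hin
    have hieq : (i : ℕ) = n := by omega
    -- apply φ n to the relation: only the i-th term survives
    have h := congrArg (φ n) hg
    rw [map_sum, map_zero] at h
    rw [Finset.sum_eq_single i] at h
    · rw [map_smul] at h
      rcases smul_eq_zero.mp h with h0 | h0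
      · exact h0
      · rw [hieq] at h0
        exact absurd h0 (hdiag n (hieq ▸ i.isLt))
    · intro b _ hb
      rw [map_smul]
      have hbn : (b : ℕ) ≠ n := fun h' ↦ hb (Fin.ext (by rw [h', hieq]))
      rcases Nat.lt_or_gt_of_ne hbn with hlt | hgt
      · rw [ih b hlt, zero_smul]
      · rw [hupper b n hgt b.isLt, smul_zero]
    · intro hi'
      exact absurd (Finset.mem_univ i) hi'

variable {P : Type*} {Hv : P → Type*} [∀ v, AddCommGroup (Hv v)] [∀ v, Module F (Hv v)]

/-- **One step of the dimension count**: if a localisation `loc₀` takes values on the line through `e` on a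
finite-dimensional subspace `K`, and its kernel on `K` lies in `K'`, then `dim K ≤ 1 + dim K'` (rank–nullity).
[cite: WZhang2014, proof of Lemma 8.4 (3), pp. 238–239 («by a dimension counting»)] -/
theorem finrank_le_one_add_of_line {T : Type*} [AddCommGroup T] [Module F T] (loc₀ : H →ₗ[F] T)
    (K K' : Submodule F H) [FiniteDimensional F K] [FiniteDimensional F K'] (e : T)
    (hline : ∀ x ∈ K, ∃ a : F, loc₀ x = a • e) (hker : ∀ x ∈ K, loc₀ x = 0 → x ∈ K') :
    finrank F K ≤ 1 + finrank F K' := by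
  let φ : K →ₗ[F] T := loc₀.domRestrict K
  have hrange : LinearMap.range φ ≤ Submodule.span F {e} := by
    rintro y ⟨x, rfl⟩
    obtain ⟨a, ha⟩ := hline x x.2
    rw [LinearMap.domRestrict_apply, ha]
    exact Submodule.smul_mem _ a (Submodule.subset_span rfl)
  have hrange1 : finrank F (LinearMap.range φ) ≤ 1 :=
    calc finrank F (LinearMap.range φ) ≤ finrank F (Submodule.span F ({e} : Set T)) :=
          Submodule.finrank_mono hrange
      _ ≤ ({e} : Set T).toFinset.card := finrank_span_le_card _
      _ = 1 := by rw [Set.toFinset_singleton, Finset.card_singleton]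
  have hmem : ∀ x : LinearMap.ker φ, (K.subtype ∘ₗ (LinearMap.ker φ).subtype) x ∈ K' := by
    intro x
    have hx0 : loc₀ ((x : K) : H) = 0 := by
      have := LinearMap.mem_ker.mp x.2
      rwa [LinearMap.domRestrict_apply] at this
    exact hker _ (x : K).2 hx0
  let ψ : LinearMap.ker φ →ₗ[F] K' := LinearMap.codRestrict K' (K.subtype ∘ₗ (LinearMap.ker φ).subtype) hmem
  have hψ : Function.Injective ψ := by
    intro x y hxy
    have h1 : ((x : K) : H) = ((y : K) : H) := congrArg (fun z : K' ↦ (z : H)) hxy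
    exact Subtype.ext (Subtype.ext h1)
  have hkerle : finrank F (LinearMap.ker φ) ≤ finrank F K' := LinearMap.finrank_le_finrank_of_injective hψ
  have hsum : finrank F (LinearMap.range φ) + finrank F (LinearMap.ker φ) = finrank F K :=
    LinearMap.finrank_range_add_finrank_ker φ
  omega

/-- **Dimension count along a filtration by localisation kernels** (the «dimension counting» of the proof of Lemma
8.4 (3), p. 239, and the reduction «perhaps subtracting c by a suitable linear combination of c(nᵢ)'s», p. 238): if
on a finite-dimensional subspace `V` each localisation `loc (v j)`, `j < k`, takes values on the line through `e j`,
then `dim V ≤ k + dim {x ∈ V | loc (v j) x = 0 ∀ j < k}`. [cite: WZhang2014, proof of Lemma 8.4 (3), pp. 238–239] -/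
theorem finrank_le_add_finrank_inf_iInf_ker (loc : (v : P) → H →ₗ[F] Hv v) (V : Submodule F H)
    [FiniteDimensional F V] (v : ℕ → P) (e : (j : ℕ) → Hv (v j)) :
    ∀ k : ℕ, (∀ j < k, ∀ x ∈ V, ∃ a : F, loc (v j) x = a • e j) →
      finrank F V ≤ k + finrank F ↥(V ⊓ ⨅ (j : ℕ) (_ : j < k), LinearMap.ker (loc (v j))) := by
  intro k
  induction k with
  | zero =>
    intro _
    have hle : V ≤ V ⊓ ⨅ (j : ℕ) (_ : j < 0), LinearMap.ker (loc (v j)) :=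
      le_inf le_rfl (le_iInf₂ fun j hj ↦ absurd hj (Nat.not_lt_zero j))
    haveI : FiniteDimensional F ↥(V ⊓ ⨅ (j : ℕ) (_ : j < 0), LinearMap.ker (loc (v j))) :=
      Submodule.finiteDimensional_of_le inf_le_left
    rw [zero_add]
    exact Submodule.finrank_mono hle
  | succ k ih =>
    intro hline
    have hk : finrank F V ≤ k + finrank F ↥(V ⊓ ⨅ (j : ℕ) (_ : j < k), LinearMap.ker (loc (v j))) :=
      ih fun j hj ↦ hline j (Nat.lt_succ_of_lt hj)
    haveI : FiniteDimensional F ↥(V ⊓ ⨅ (j : ℕ) (_ : j < k), LinearMap.ker (loc (v j))) :=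
      Submodule.finiteDimensional_of_le inf_le_left
    haveI : FiniteDimensional F ↥(V ⊓ ⨅ (j : ℕ) (_ : j < k + 1), LinearMap.ker (loc (v j))) :=
      Submodule.finiteDimensional_of_le inf_le_left
    have hstep : finrank F ↥(V ⊓ ⨅ (j : ℕ) (_ : j < k), LinearMap.ker (loc (v j))) ≤
        1 + finrank F ↥(V ⊓ ⨅ (j : ℕ) (_ : j < k + 1), LinearMap.ker (loc (v j))) := by
      refine finrank_le_one_add_of_line (loc (v k)) _ _ (e k) (fun x hx ↦ ?_) (fun x hx hx0 ↦ ?_)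
      · exact hline k (Nat.lt_succ_self k) x (Submodule.mem_inf.mp hx).1
      · refine Submodule.mem_inf.mpr ⟨(Submodule.mem_inf.mp hx).1, ?_⟩
        refine (Submodule.mem_iInf _).mpr fun j ↦ (Submodule.mem_iInf _).mpr fun hj ↦ ?_
        rcases Nat.lt_succ_iff_lt_or_eq.mp hj with hj | rfl
        · exact (Submodule.mem_iInf _).mp ((Submodule.mem_iInf _).mp (Submodule.mem_inf.mp hx).2 j) hj
        · exact LinearMap.mem_ker.mpr hx0
    omega

/-! ## §2 The vanishing order: minimal classes are Selmer

From here on the data of a Kolyvagin system at one fixed level (module docstring). In the hypotheses, `hfs` is the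
consequence of (8.1) that is used, `hcL` ∕ `hcT` are property (1) off ∕ on the support. -/

variable {ι : Type*}

/-- **Classes at the vanishing order vanish locally on their own support** (the sentence «It is clearly c(nᵢ) … in
the Selmer group», p. 238): if every class on fewer than `ν` primes is zero, then for `m` on `ν` primes and `ℓ ∈ m`,
`loc_ℓ c(m) = 0` — by (8.1), `loc_ℓ c(m) = ψ_ℓ(loc_ℓ c(m ∕ ℓ))` and `c(m ∕ ℓ) = 0`. [cite: WZhang2014, (8.1) and
proof of Lemma 8.4, p. 238] -/
theorem loc_eq_zero_of_mem_of_card_eq [DecidableEq ι] (loc : (v : P) → H →ₗ[F] Hv v) (pl : ι → P) (c : Finset ι → H)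
    (hfs : ∀ (m : Finset ι) (ℓ : ι), ℓ ∉ m → (loc (pl ℓ) (c (insert ℓ m)) = 0 ↔ loc (pl ℓ) (c m) = 0))
    {ν : ℕ} (hmin : ∀ m : Finset ι, m.card < ν → c m = 0)
    {m : Finset ι} (hm : m.card = ν) {ℓ : ι} (hℓ : ℓ ∈ m) : loc (pl ℓ) (c m) = 0 := by
  have hins : insert ℓ (m.erase ℓ) = m := Finset.insert_erase hℓ
  have hnot : ℓ ∉ m.erase ℓ := Finset.notMem_erase ℓ m
  have hpos : 0 < m.card := Finset.card_pos.mpr ⟨ℓ, hℓ⟩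
  have hlt : (m.erase ℓ).card < ν := by rw [Finset.card_erase_of_mem hℓ]; omega
  rw [← hins, hfs (m.erase ℓ) ℓ hnot, hmin (m.erase ℓ) hlt, map_zero]

/-- **Classes at the vanishing order are Selmer classes of their sign**: with `Sel s = {x ∈ E s | loc_v x ∈ L v ∀ v}`,
a class on `ν` primes (minimal) lies in `Sel (ε₀ ^^ Nat.bodd ν)` — property (1) off the support, the previous lemma
on it. [cite: WZhang2014, §8.1 property (1), proof of Lemma 8.4, p. 238] -/
theorem mem_sel_of_card_eq [DecidableEq ι] (E : Bool → Submodule F H) (loc : (v : P) → H →ₗ[F] Hv v)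
    (L : (v : P) → Submodule F (Hv v)) (pl : ι → P) (c : Finset ι → H) (ε₀ : Bool)
    (Sel : Bool → Submodule F H) (hSel : ∀ (s : Bool) (x : H), x ∈ Sel s ↔ x ∈ E s ∧ ∀ v, loc v x ∈ L v)
    (hcE : ∀ m : Finset ι, c m ∈ E (ε₀ ^^ Nat.bodd m.card))
    (hcL : ∀ (m : Finset ι) (v : P), (∀ ℓ ∈ m, pl ℓ ≠ v) → loc v (c m) ∈ L v)
    (hfs : ∀ (m : Finset ι) (ℓ : ι), ℓ ∉ m → (loc (pl ℓ) (c (insert ℓ m)) = 0 ↔ loc (pl ℓ) (c m) = 0))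
    {ν : ℕ} (hmin : ∀ m : Finset ι, m.card < ν → c m = 0)
    {m : Finset ι} (hm : m.card = ν) : c m ∈ Sel (ε₀ ^^ Nat.bodd ν) := by
  refine (hSel _ _).mpr ⟨hm ▸ hcE m, fun v ↦ ?_⟩
  by_cases hv : ∃ ℓ ∈ m, pl ℓ = v
  · obtain ⟨ℓ, hℓ, rfl⟩ := hv
    rw [loc_eq_zero_of_mem_of_card_eq loc pl c hfs hmin hm hℓ]
    exact Submodule.zero_mem _
  · push Not at hv
    exact hcL m v hv

/-- **Global reciprocity, read on the Kolyvagin support** ((8.4): «We calculate the Tate pairing, as a sum of the local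
Tate pairing over all places»): if the local terms of two classes vanish at every place not of the form `pl ℓ`,
`ℓ ∈ m`, then the sum of the local terms over `m` is zero. [cite: WZhang2014, (8.4) and p. 239] -/
theorem sum_pairing_eq_zero [DecidableEq P] (loc : (v : P) → H →ₗ[F] Hv v) (b : (v : P) → Hv v →ₗ[F] Hv v →ₗ[F] F)
    (pl : ι → P) (hpl : Function.Injective pl)
    (hrec : ∀ (x y : H) (T : Finset P), (∀ v, v ∉ T → b v (loc v x) (loc v y) = 0) →
      ∑ v ∈ T, b v (loc v x) (loc v y) = 0)
    (x y : H) (m : Finset ι) (hoff : ∀ v : P, (∀ ℓ ∈ m, pl ℓ ≠ v) → b v (loc v x) (loc v y) = 0) :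
    ∑ ℓ ∈ m, b (pl ℓ) (loc (pl ℓ) x) (loc (pl ℓ) y) = 0 := by
  have h := hrec x y (m.image pl) fun v hv ↦ hoff v fun ℓ hℓ h' ↦ hv (Finset.mem_image.mpr ⟨ℓ, hℓ, h'⟩)
  rwa [Finset.sum_image (fun a _ b _ h' ↦ hpl h')] at h

/-! ## §3 One sliding step (Zhang pp. 237–238, (8.3)–(8.5)) -/

/-- Sign bookkeeping: adding one prime flips the sign. [folklore] -/
theorem sign_succ (ε₀ : Bool) (n : ℕ) : (ε₀ ^^ Nat.bodd (n + 1)) = !(ε₀ ^^ Nat.bodd n) := by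
  rw [Nat.bodd_succ]
  cases ε₀ <;> cases Nat.bodd n <;> rfl

/-- **The sliding step of Zhang's construction** ((8.3)–(8.5)). Data at one level as in the module docstring; `m` a
set of `ν` Kolyvagin primes with `c(m) ≠ 0` (minimality of `ν` is NOT needed here), `ℓ ∈ m` (the prime to be dropped),
`S` any finite set of primes to avoid. Then there is a Kolyvagin prime `ℓ' ∉ S ∪ m` with `loc_{ℓ'} c(m) ≠ 0` and
`c((m ∪ {ℓ'}) ∖ {ℓ}) ≠ 0`. Proof = the source's: Lemma 8.2 supplies `x ≠ 0` of the opposite sign, Selmer off `m`,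
transverse on `m ∖ {ℓ}`; Lemma 8.1 gives `ℓ'` seeing both `x` and `c(m)`; pairing `x` with `c(m ℓ')` (same sign),
the only local terms are at `ℓ'` (non-zero: finite × transverse of the same sign, `loc_{ℓ'} c(mℓ') ≠ 0` by (8.1)) and
at `ℓ`; reciprocity forces the term at `ℓ` to be non-zero, so `loc_ℓ c(mℓ') ≠ 0`, i.e. by (8.1) `loc_ℓ c(mℓ'∕ℓ) ≠ 0`.
[cite: WZhang2014, proof of Lemma 8.4, pp. 237–238, (8.3)–(8.5)] [cite: McCallumLMS1991, Prop. 3.1, Lemma 5.3] -/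
theorem slide [DecidableEq ι] [DecidableEq P] (E : Bool → Submodule F H) (loc : (v : P) → H →ₗ[F] Hv v)
    (b : (v : P) → Hv v →ₗ[F] Hv v →ₗ[F] F) (L : (v : P) → Submodule F (Hv v))
    (pl : ι → P) (Fv Tv : (ℓ : ι) → Submodule F (Hv (pl ℓ))) (c : Finset ι → H) (ε₀ : Bool)
    (hpl : Function.Injective pl)
    (hLF : ∀ ℓ, L (pl ℓ) = Fv ℓ)
    (hisoL : ∀ (v : P), ∀ x ∈ L v, ∀ y ∈ L v, b v x y = 0)
    (hisoT : ∀ (ℓ : ι), ∀ x ∈ Tv ℓ, ∀ y ∈ Tv ℓ, b (pl ℓ) x y = 0)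
    (hperf : ∀ (ℓ : ι) (s : Bool), ∀ x ∈ E s, ∀ y ∈ E s, loc (pl ℓ) x ∈ Fv ℓ → loc (pl ℓ) x ≠ 0 →
      loc (pl ℓ) y ∈ Tv ℓ → loc (pl ℓ) y ≠ 0 → b (pl ℓ) (loc (pl ℓ) x) (loc (pl ℓ) y) ≠ 0)
    (hrec : ∀ (x y : H) (T : Finset P), (∀ v, v ∉ T → b v (loc v x) (loc v y) = 0) →
      ∑ v ∈ T, b v (loc v x) (loc v y) = 0)
    (hcE : ∀ m : Finset ι, c m ∈ E (ε₀ ^^ Nat.bodd m.card))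
    (hcL : ∀ (m : Finset ι) (v : P), (∀ ℓ ∈ m, pl ℓ ≠ v) → loc v (c m) ∈ L v)
    (hcT : ∀ (m : Finset ι), ∀ ℓ ∈ m, loc (pl ℓ) (c m) ∈ Tv ℓ)
    (hfs : ∀ (m : Finset ι) (ℓ : ι), ℓ ∉ m → (loc (pl ℓ) (c (insert ℓ m)) = 0 ↔ loc (pl ℓ) (c m) = 0))
    (hCheb2 : ∀ (s : Bool), ∀ x ∈ E s, ∀ y ∈ E (!s), x ≠ 0 → y ≠ 0 → ∀ S : Finset ι,
      ∃ ℓ, ℓ ∉ S ∧ loc (pl ℓ) x ≠ 0 ∧ loc (pl ℓ) y ≠ 0)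
    (hSupply : ∀ (ℓ : ι) (S : Finset ι), ℓ ∉ S → ∀ s : Bool, ∃ x ∈ E s, x ≠ 0 ∧
      (∀ v : P, v ≠ pl ℓ → (∀ ℓ' ∈ S, pl ℓ' ≠ v) → loc v x ∈ L v) ∧ ∀ ℓ' ∈ S, loc (pl ℓ') x ∈ Tv ℓ')
    {ν : ℕ} {m : Finset ι} (hm : m.card = ν) (hcm : c m ≠ 0) {ℓ : ι} (hℓ : ℓ ∈ m) (S : Finset ι) :
    ∃ ℓ', ℓ' ∉ S ∧ ℓ' ∉ m ∧ loc (pl ℓ') (c m) ≠ 0 ∧ c (insert ℓ' (m.erase ℓ)) ≠ 0 := by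
  have hcm_sign : c m ∈ E (ε₀ ^^ Nat.bodd ν) := hm ▸ hcE m
  -- Lemma 8.2: the auxiliary class x of sign ¬s, Selmer off m, transverse on m \ {ℓ}
  have hℓS₀ : ℓ ∉ m.erase ℓ := Finset.notMem_erase ℓ m
  obtain ⟨x, hxE, hx0, hxL, hxT⟩ := hSupply ℓ (m.erase ℓ) hℓS₀ (!(ε₀ ^^ Nat.bodd ν))
  -- Lemma 8.1: a fresh prime ℓ' seeing x and c(m)
  have hcm' : c m ∈ E (!!(ε₀ ^^ Nat.bodd ν)) := by rw [Bool.not_not]; exact hcm_sign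
  obtain ⟨ℓ', hℓ'S, hℓ'x, hℓ'c⟩ := hCheb2 (!(ε₀ ^^ Nat.bodd ν)) x hxE (c m) hcm' hx0 hcm (S ∪ m)
  have hℓ'S' : ℓ' ∉ S := fun h ↦ hℓ'S (Finset.mem_union_left _ h)
  have hℓ'm : ℓ' ∉ m := fun h ↦ hℓ'S (Finset.mem_union_right _ h)
  have hℓℓ' : ℓ ≠ ℓ' := fun h ↦ hℓ'm (h ▸ hℓ)
  refine ⟨ℓ', hℓ'S', hℓ'm, hℓ'c, ?_⟩
  -- y := c (m ∪ {ℓ'}) has the sign of x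
  have hcard : (insert ℓ' m).card = ν + 1 := by rw [Finset.card_insert_of_notMem hℓ'm, hm]
  have hyE : c (insert ℓ' m) ∈ E (!(ε₀ ^^ Nat.bodd ν)) := by
    have := hcE (insert ℓ' m)
    rwa [hcard, sign_succ] at this
  -- the local term at ℓ' is non-zero
  have hyℓ' : loc (pl ℓ') (c (insert ℓ' m)) ≠ 0 := fun h ↦ hℓ'c ((hfs m ℓ' hℓ'm).mp h)
  have hxℓ'L : loc (pl ℓ') x ∈ Fv ℓ' := by
    rw [← hLF]
    refine hxL (pl ℓ') (fun h ↦ hℓℓ' (hpl h).symm) fun ℓ'' hℓ'' h ↦ ?_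
    exact hℓ'm ((hpl h) ▸ Finset.mem_of_mem_erase hℓ'')
  have htermℓ' : b (pl ℓ') (loc (pl ℓ') x) (loc (pl ℓ') (c (insert ℓ' m))) ≠ 0 :=
    hperf ℓ' _ x hxE _ hyE hxℓ'L hℓ'x (hcT _ ℓ' (Finset.mem_insert_self ℓ' m)) hyℓ'
  -- reciprocity over the support m ∪ {ℓ'}
  have hsum : ∑ ℓ'' ∈ insert ℓ' m, b (pl ℓ'') (loc (pl ℓ'') x) (loc (pl ℓ'') (c (insert ℓ' m))) = 0 := by
    refine sum_pairing_eq_zero loc b pl hpl hrec x _ (insert ℓ' m) fun v hv ↦ ?_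
    have hvℓ : v ≠ pl ℓ := fun h ↦ hv ℓ (Finset.mem_insert_of_mem hℓ) h.symm
    have hvS : ∀ ℓ'' ∈ m.erase ℓ, pl ℓ'' ≠ v :=
      fun ℓ'' hℓ'' ↦ hv ℓ'' (Finset.mem_insert_of_mem (Finset.mem_of_mem_erase hℓ''))
    exact hisoL v _ (hxL v hvℓ hvS) _ (hcL _ v hv)
  -- split the sum: ℓ', ℓ, and the transverse primes of m \ {ℓ}
  rw [Finset.sum_insert hℓ'm, ← Finset.add_sum_erase m _ hℓ] at hsum
  have hrest :
      ∑ ℓ'' ∈ m.erase ℓ, b (pl ℓ'') (loc (pl ℓ'') x) (loc (pl ℓ'') (c (insert ℓ' m))) = 0 := by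
    refine Finset.sum_eq_zero fun ℓ'' hℓ'' ↦ ?_
    exact hisoT ℓ'' _ (hxT ℓ'' hℓ'') _
      (hcT _ ℓ'' (Finset.mem_insert_of_mem (Finset.mem_of_mem_erase hℓ'')))
  rw [hrest, add_zero] at hsum
  -- so the term at ℓ is non-zero, hence loc_ℓ y ≠ 0
  have htermℓ : b (pl ℓ) (loc (pl ℓ) x) (loc (pl ℓ) (c (insert ℓ' m))) ≠ 0 := by
    intro h
    rw [h, add_zero] at hsum
    exact htermℓ' hsum
  have hyℓ : loc (pl ℓ) (c (insert ℓ' m)) ≠ 0 := by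
    intro h
    rw [h, map_zero] at htermℓ
    exact htermℓ rfl
  -- (8.1) at ℓ: y = c (insert ℓ m') with m' = (m \ {ℓ}) ∪ {ℓ'}
  have hℓm' : ℓ ∉ insert ℓ' (m.erase ℓ) := by
    rw [Finset.mem_insert, not_or]
    exact ⟨hℓℓ', hℓS₀⟩
  have hins : insert ℓ (insert ℓ' (m.erase ℓ)) = insert ℓ' m := by
    rw [Finset.insert_comm, Finset.insert_erase hℓ]
  intro h0
  have : loc (pl ℓ) (c (insert ℓ (insert ℓ' (m.erase ℓ)))) = 0 :=
    (hfs _ ℓ hℓm').mpr (by rw [h0, map_zero])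
  rw [hins] at this
  exact hyℓ this

end Summit.BirchSwinnertonDyer.Rank1Residual.X11b.Three.Koly.ZhangTriangulation
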